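import Summits.QuantumFields.YangMills.Theorems.BalabanUVNodesPortU8IotaRow

/-!
# PORT PT-B (U8), file 5 — TRANSPORT of the ι-row's `C²` clause: `ContDiffAt ℝ 2 (recordEmbJ F θ k K) 0` FROM the `C²`-dependence of the rooted-gauge
# background field `B ↦ U_{k+1}(W_B)` at `B = 0` (the record's reading of [15] Prop. 9 «analytic function of V′», displayed as the ONE hypothesis)

Cell `ym-nodeO-ideate` ∕ `ym-balaban-port`, porter `ymgap-nodeO-port-PTB-1` (gen 0), item **stmt-QuantumFields-27931** `BalabanUVNodes.PortPieceLocalityU8` (string ⁶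
`nodeO-cover/TYPER-Sig27931-v6-J.txt`, sha16 `3e2971674efa3b12`); PORT-PLAN-v1 row U8-C2 (transport half); `--kind proof --supports stmt-QuantumFields-27931` (helper).
[I] = [Balaban1987RG1], [15] = [Balaban1985Variational].  CONSUMED BY NAME: DEF-1's names (`recordBgField ∕ recordBgUnits ∕ recordCurrent ∕ recordEmbJ ∕ sl2Coord ∕ sl2Proj ∕
thetaFill ∕ recordK₀`), file 1 (`PortU8.recordBgField_zero`), the tree's `MatrixLog.analyticAt_mlog`, `B12Eq18Current.current ∕ imPlaq ∕ dirForm`, `B9Eq39Adjoint.divP ∕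
divPη ∕ covDstar ∕ R ∕ plaqU`, `B9Eq37Insertion.imC`, Mathlib's `ContDiffAt` calculus and `LinearMap.toContinuousLinearMap` (finite dimensions).
WHAT THIS FILE PROVES (theorems only; no `def ∕ instance ∕ notation ∕ sorry`; standard axioms).
§1 the linear letters are smooth over ℝ: `contDiff_entry`, `contDiff_sl2Coord`, `contDiff_star'` (conjugate transpose), `contDiff_sl2Proj`.
§2 ★ `contDiffAt_current` — the current (1.8) `J(𝐔) = D^{ξ*} ξ⁻² π Im ∂𝐔` is `Cⁿ` along ANY family of bond variables `e ↦ 𝐔_e` whose values AND inverses are `Cⁿ`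
   (`contDiffAt_plaqU`, `contDiffAt_imPlaq`, `contDiffAt_covDstar`: products, inverses in reversed order, sums, the fixed projection `π`).
§3 `coe_recordBgUnits(_inv)` (the inverse bond variable of the `SU(2)`-valued background field is its conjugate transpose); ★★ `contDiffAt_recordEmbJ_of` — IF
   `B ↦ (U_{k+1}(W_B)(b))_b ∈ M₂(ℂ)^{bonds}` is `C²` at `B = 0` THEN `recordEmbJ F θ k K` is `C²` at `0` (`log` is analytic at `U_{k+1}(W_0) = 1` — file 1 — and the current is
   polynomial in `U`, `U*`); ★ `contDiffAt_recordEmbJ_thetaFill_of` — the port text's instance (`θ := thetaFill F a₀ ε₂₉`, volumes `recordK₀ F Mc k + n`).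
RESIDUE RECORDED: with this file the ι-row's `C²` clause (C2a) of 27931⁶ reduces to the single displayed hypothesis «`B ↦ U_{k+1}(W_B)` is `C²` at `0` in the rooted gauge»
(PORT-PLAN-v1 §4 TokP9-reg) — [15] Thm 1 + Prop. 9 at `UkSel`, off the flat sector; NOT proved here.  §4 (v2 APPEND, after CRIT-1's re-signature 27931⁷ 2b1f3e71e82c2820
displaying TokP9reg ENTRYWISE as `AnalyticAt ℝ`): `contDiffAt_matrix_of_entries(_analyticAt)` (sup-normed entries ⇒ L²-op-normed matrices, finite dimensions) and
★★ `contDiffAt_recordEmbJ_of_tokP9reg` — (C2a) FROM ⁷'s token TokP9reg in its verbatim shape.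
HONEST FRAMING.  Calculus bookkeeping; NOTHING of Bałaban's analysis asserted, ported or discharged; 27931⁶ OPEN; K0⁷ NOT closed; NODE O 0∕1; COUNT 8∕28 · K 1∕4 UNMOVED; finite
`𝕋⁴_{L^K}` at fixed ε — NOT continuum ∕ OS ∕ Clay; **the Yang–Mills mass gap (Clay) is NOT proved by any of this.**
-/

noncomputable section

open scoped BigOperators Matrix.Norms.L2Operator

namespace Summit.QuantumFields.YangMills.Theorems.PortU8

open Literature.MathematicalPhysics.QuantumFieldTheory.Balaban1983to89
open Literature.MathematicalPhysics.QuantumFieldTheory.Balaban1983to89.Node00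
open Literature.MathematicalPhysics.QuantumFieldTheory.Balaban1983to89.T4Continuum (T4Family)
open Summit.QuantumFields.YangMills.Theorems.K0RecordFormatNames
open NormedSpace (exp)

/-! ## §1  The linear letters are smooth: matrix entries, `sl2Coord`, `star`, `sl2Proj` -/

/-- A matrix entry is a smooth (ℝ-linear) function of the matrix. [folklore] -/
theorem contDiff_entry {n : WithTop ℕ∞} (i j : Fin 2) : ContDiff ℝ n (fun A : MatA 2 => A i j) :=
  (LinearMap.toContinuousLinearMap
    ({ toFun := fun A : MatA 2 => A i j, map_add' := fun _ _ => rfl, map_smul' := fun _ _ => rfl } : MatA 2 →ₗ[ℝ] ℂ)).contDiff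

/-- Each 𝔰𝔩₂-coordinate is a smooth function of the matrix. [cite: Balaban1987RG1, (1.10) p.262 (bookkeeping)] -/
theorem contDiff_sl2Coord {n : WithTop ℕ∞} (a : Fin 3) : ContDiff ℝ n (fun A : MatA 2 => sl2Coord A a) := by
  fin_cases a
  · simpa [sl2Coord] using contDiff_entry (n := n) 0 1
  · simpa [sl2Coord] using contDiff_entry (n := n) 1 0
  · simpa [sl2Coord] using ((contDiff_entry (n := n) 0 0).sub (contDiff_entry (n := n) 1 1)).div_const (2 : ℂ)

/-- `star` (the conjugate transpose) is smooth on `M₂(ℂ)` over ℝ: it is a continuous ℝ-linear map (finite dimensions). [folklore] -/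
theorem contDiff_star' {n : WithTop ℕ∞} : ContDiff ℝ n (fun A : MatA 2 => star A) :=
  (LinearMap.toContinuousLinearMap
    ({ toFun := fun A => star A
       map_add' := fun A B => star_add A B
       map_smul' := fun c A => by rw [star_smul, star_trivial]; rfl } : MatA 2 →ₗ[ℝ] MatA 2)).contDiff

/-- The traceless projection `sl2Proj` is smooth (ℂ-linear on a finite-dimensional space). [cite: Balaban1987RG1, (1.8) p.261 (bookkeeping)] -/
theorem contDiff_sl2Proj {n : WithTop ℕ∞} : ContDiff ℝ n (fun A : MatA 2 => sl2Proj A) :=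
  (LinearMap.toContinuousLinearMap (sl2Proj.restrictScalars ℝ)).contDiff

/-! ## §2  The current (1.8) is a smooth function of the bond variables and their inverses -/

section CurrentSmooth

variable {E : Type*} [NormedAddCommGroup E] [NormedSpace ℝ E] {P : Params} {i : ℕ} {n : WithTop ℕ∞}

/-- If every bond variable `↑(W e b)` and every inverse `↑(W e b)⁻¹` is `Cⁿ` at `e₀`, then so is every plaquette variable `↑(∂W)(p)`.
[cite: Balaban1985BackgroundPropagators, (3.1) p.390 (bookkeeping)] -/
theorem contDiffAt_plaqU {W : E → PBond P i → (MatA 2)ˣ} {e₀ : E}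
    (hW : ∀ b, ContDiffAt ℝ n (fun e => (W e b : MatA 2)) e₀) (hW' : ∀ b, ContDiffAt ℝ n (fun e => (((W e b)⁻¹ : (MatA 2)ˣ) : MatA 2)) e₀)
    (μ ν : Fin P.d) (x : Site P i) :
    ContDiffAt ℝ n (fun e => (B9Eq39Adjoint.plaqU (B9TorusCalculus.torusT P i) (B12Eq18Current.dirForm (W e)) μ ν x : MatA 2)) e₀ ∧
      ContDiffAt ℝ n (fun e => (((B9Eq39Adjoint.plaqU (B9TorusCalculus.torusT P i) (B12Eq18Current.dirForm (W e)) μ ν x)⁻¹ : (MatA 2)ˣ) : MatA 2)) e₀ := by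
  constructor
  · simp only [B9Eq39Adjoint.plaqU, B12Eq18Current.dirForm, Units.val_mul]
    exact (((hW _).mul (hW _)).mul (hW' _)).mul (hW' _)
  · simp only [B9Eq39Adjoint.plaqU, B12Eq18Current.dirForm, mul_inv_rev, inv_inv, Units.val_mul]
    exact (hW _).mul ((hW _).mul ((hW' _).mul (hW' _)))

/-- … then so is `ξ⁻² π Im ∂W (p)`. [cite: Balaban1987RG1, (1.8) p.261 (bookkeeping)] -/
theorem contDiffAt_imPlaq {W : E → PBond P i → (MatA 2)ˣ} {e₀ : E}
    (hW : ∀ b, ContDiffAt ℝ n (fun e => (W e b : MatA 2)) e₀) (hW' : ∀ b, ContDiffAt ℝ n (fun e => (((W e b)⁻¹ : (MatA 2)ˣ) : MatA 2)) e₀)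
    (π : MatA 2 →ₗ[ℂ] MatA 2) (ξ : ℝ) (μ ν : Fin P.d) (x : Site P i) :
    ContDiffAt ℝ n (fun e => B12Eq18Current.imPlaq π ξ (W e) μ ν x) e₀ := by
  have hπ : ContDiff ℝ n (fun A : MatA 2 => π A) := (LinearMap.toContinuousLinearMap (π.restrictScalars ℝ)).contDiff
  obtain ⟨h1, h2⟩ := contDiffAt_plaqU hW hW' μ ν x
  unfold B12Eq18Current.imPlaq B9Eq37Insertion.imC
  exact (hπ.contDiffAt.comp e₀ ((h1.sub h2).const_smul _)).const_smul _

/-- … then so is every `D*_ν`-term `R(W(y)⁻¹) G(y) − G(x)` for `Cⁿ` plaquette data `G`. [cite: Balaban1985BackgroundPropagators, (3.8) p.392 (bookkeeping)] -/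
theorem contDiffAt_covDstar {W : E → PBond P i → (MatA 2)ˣ} {e₀ : E}
    (hW : ∀ b, ContDiffAt ℝ n (fun e => (W e b : MatA 2)) e₀) (hW' : ∀ b, ContDiffAt ℝ n (fun e => (((W e b)⁻¹ : (MatA 2)ˣ) : MatA 2)) e₀)
    {G : E → Site P i → MatA 2} (hG : ∀ x, ContDiffAt ℝ n (fun e => G e x) e₀) (ν : Fin P.d) (x : Site P i) :
    ContDiffAt ℝ n (fun e => B9Eq39Adjoint.covDstar (B9TorusCalculus.torusT P i) (B12Eq18Current.dirForm (W e)) ν (G e) x) e₀ := by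
  unfold B9Eq39Adjoint.covDstar B9Eq39Adjoint.R
  simp only [inv_inv, B12Eq18Current.dirForm]
  exact (((hW' _).mul (hG _)).mul (hW _)).sub (hG _)

/-- **THE CURRENT (1.8) IS `Cⁿ` IN ANY `Cⁿ` FAMILY OF BOND VARIABLES WITH `Cⁿ` INVERSES.** [cite: Balaban1987RG1, (1.8) p.261] -/
theorem contDiffAt_current {W : E → PBond P i → (MatA 2)ˣ} {e₀ : E}
    (hW : ∀ b, ContDiffAt ℝ n (fun e => (W e b : MatA 2)) e₀) (hW' : ∀ b, ContDiffAt ℝ n (fun e => (((W e b)⁻¹ : (MatA 2)ˣ) : MatA 2)) e₀)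
    (π : MatA 2 →ₗ[ℂ] MatA 2) (ξ : ℝ) (b : PBond P i) :
    ContDiffAt ℝ n (fun e => B12Eq18Current.current π ξ (W e) b) e₀ := by
  have hF : ∀ μ ν x, ContDiffAt ℝ n (fun e => B12Eq18Current.imPlaq π ξ (W e) μ ν x) e₀ := contDiffAt_imPlaq hW hW' π ξ
  have hterm : ∀ (c : Prop) [Decidable c] (ν μ μ' : Fin P.d),
      ContDiffAt ℝ n (fun e => if c then B9Eq39Adjoint.covDstar (B9TorusCalculus.torusT P i) (B12Eq18Current.dirForm (W e)) ν
        (B12Eq18Current.imPlaq π ξ (W e) μ μ') b.src else 0) e₀ := by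
    intro c _ ν μ μ'
    by_cases hc : c
    · simp only [if_pos hc]
      exact contDiffAt_covDstar hW hW' (fun x => hF μ μ' x) ν b.src
    · simp only [if_neg hc]
      exact contDiffAt_const
  unfold B12Eq18Current.current B9Eq39Adjoint.divPη B9Eq39Adjoint.divP
  refine ((ContDiffAt.sum fun ν _ => ?_).sub (ContDiffAt.sum fun ν _ => ?_)).const_smul _
  · exact hterm _ ν ν b.dir
  · exact hterm _ ν b.dir ν

end CurrentSmooth

/-! ## §3  The record: bond variables of the charted background field and their inverses at `B = 0` -/

variable (F : T4Family) (θ : Stage13Params F 2)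

/-- The units-valued background field reads the `SU(2)`-valued one (`coe_ιSU`). [cite: Balaban1987RG1, (1.8)–(1.9) p.261 (bookkeeping)] -/
theorem coe_recordBgUnits (k K : ℕ) (B : Fin (F.P K).d → Site (F.P K) (k + 1) → θ.Vβ) (b : PBond (F.P K) 0) :
    ((recordBgUnits F θ k K B b : (MatA 2)ˣ) : MatA 2) = ((recordBgField F θ k K B b : SU 2) : MatA 2) := rfl

/-- The inverse bond variable is the conjugate transpose (`SU(2)`: `g⁻¹ = g*`). [cite: Balaban1987RG1, (1.10) p.262 (bookkeeping)] -/
theorem coe_recordBgUnits_inv (k K : ℕ) (B : Fin (F.P K).d → Site (F.P K) (k + 1) → θ.Vβ) (b : PBond (F.P K) 0) :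
    (((recordBgUnits F θ k K B b)⁻¹ : (MatA 2)ˣ) : MatA 2) = star ((recordBgField F θ k K B b : SU 2) : MatA 2) := by
  show (((ιSU 2 (recordBgField F θ k K B b))⁻¹ : (MatA 2)ˣ) : MatA 2) = _
  rw [← map_inv, coe_ιSU, ← Matrix.star_eq_inv, Matrix.specialUnitaryGroup.coe_star]

/-- ★★ **TRANSPORT OF THE ι-ROW's `C²` CLAUSE**: if the rooted-gauge background field `B ↦ U_{k+1}(W_B)` (read in `M₂(ℂ)`, bondwise) is `C²` at `B = 0`
— [15] Prop. 9's «analytic function of V′» AT THE RECORD, displayed — then the two-block coordinate embedding `recordEmbJ F θ k K` (𝔰𝔩₂-coordinates of `log U` and of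
the current `J(U)`) is `C²` at `0` (standing range `k + 1 ≤ m + K`, `0 < θ.εbg`, so that `U_{k+1}(W_0) = 1` lies in the disc of the series logarithm).
[cite: Balaban1987RG1, (4.35) p.290, (1.8)–(1.9) p.261; Balaban1985Variational, Prop. 9 p.309] -/
theorem contDiffAt_recordEmbJ_of (k K : ℕ) (hk : k + 1 ≤ (F.P K).m + (F.P K).K) (hε : 0 < θ.εbg)
    (hU : letI := θ.instVβ₁; letI := θ.instVβ₂;
      ContDiffAt ℝ 2 (fun B : Fin (F.P K).d → Site (F.P K) (k + 1) → θ.Vβ => fun b : PBond (F.P K) 0 => ((recordBgField F θ k K B b : SU 2) : MatA 2)) 0) :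
    letI := θ.instVβ₁; letI := θ.instVβ₂; ContDiffAt ℝ 2 (recordEmbJ F θ k K) 0 := by
  letI := θ.instVβ₁; letI := θ.instVβ₂
  have hb : ∀ b, ContDiffAt ℝ 2 (fun B : Fin (F.P K).d → Site (F.P K) (k + 1) → θ.Vβ => ((recordBgField F θ k K B b : SU 2) : MatA 2)) 0 :=
    fun b => contDiffAt_pi.1 hU b
  have hW : ∀ b, ContDiffAt ℝ 2 (fun B : Fin (F.P K).d → Site (F.P K) (k + 1) → θ.Vβ => ((recordBgUnits F θ k K B b : (MatA 2)ˣ) : MatA 2)) 0 := hb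
  have hW' : ∀ b, ContDiffAt ℝ 2 (fun B : Fin (F.P K).d → Site (F.P K) (k + 1) → θ.Vβ => (((recordBgUnits F θ k K B b)⁻¹ : (MatA 2)ˣ) : MatA 2)) 0 := by
    intro b
    simp only [coe_recordBgUnits_inv]
    exact contDiff_star'.contDiffAt.comp 0 (hb b)
  -- the `log 𝐔`-block: `mlog` is analytic at `U_{k+1}(W_0)(b) = 1`
  have hlog : ∀ b (a : Fin 3), ContDiffAt ℝ 2 (fun B : Fin (F.P K).d → Site (F.P K) (k + 1) → θ.Vβ =>
      sl2Coord (MatrixLog.mlog ((recordBgField F θ k K B b : SU 2) : MatA 2)) a) 0 := by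
    intro b a
    have h0 : ((recordBgField F θ k K 0 b : SU 2) : MatA 2) = 1 := by
      rw [recordBgField_zero F θ k K hk hε]; rfl
    have hm : ContDiffAt ℝ 2 (MatrixLog.mlog : MatA 2 → MatA 2) ((recordBgField F θ k K 0 b : SU 2) : MatA 2) := by
      rw [h0]
      exact ((MatrixLog.analyticAt_mlog (by simp)).contDiffAt).restrict_scalars ℝ
    exact ContDiffAt.comp (g := fun A : MatA 2 => sl2Coord A a) 0 (contDiff_sl2Coord a).contDiffAt
      (ContDiffAt.comp (g := (MatrixLog.mlog : MatA 2 → MatA 2))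
        (f := fun B : Fin (F.P K).d → Site (F.P K) (k + 1) → θ.Vβ => ((recordBgField F θ k K B b : SU 2) : MatA 2)) 0 hm (hb b))
  -- the `𝐉`-block: the current is smooth in the bond variables and their inverses
  have hcur : ∀ b (a : Fin 3), ContDiffAt ℝ 2 (fun B : Fin (F.P K).d → Site (F.P K) (k + 1) → θ.Vβ => sl2Coord (recordCurrent F θ k K B b) a) 0 := by
    intro b a
    exact ContDiffAt.comp (g := fun A : MatA 2 => sl2Coord A a) 0 (contDiff_sl2Coord a).contDiffAt
      (contDiffAt_current hW hW' sl2Proj ((F.P K).eta (k + 1)) b)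
  rw [contDiffAt_pi]
  intro i
  obtain ⟨⟨b, t⟩, rfl⟩ := (chartEquivJ F K).surjective i
  rcases t with a | a
  · simpa [recordEmbJ] using hlog b a
  · simpa [recordEmbJ] using hcur b a


/-- ★ **THE PORT TEXT's INSTANCE**: at `θ := thetaFill F a₀ ε₂₉` (`εbg = a₀ > 0`) and the volumes `recordK₀ F Mc k + n`, the ι-row's `C²` clause of 27931⁶ follows from the
`C²`-dependence of the rooted-gauge background field on `B` at `0` — the record's reading of [15] Prop. 9 «analytic function of V′» (displayed; NOT proved here).
[cite: Balaban1987RG1, (4.35) p.290; Balaban1985Variational, Prop. 9 p.309] -/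
theorem contDiffAt_recordEmbJ_thetaFill_of (a₀ ε₂₉ : ℝ) (ha₀ : 0 < a₀) (Mc k n : ℕ)
    (hU : letI θ := thetaFill F a₀ ε₂₉; letI := θ.instVβ₁; letI := θ.instVβ₂;
      ContDiffAt ℝ 2 (fun B : Fin (F.P (recordK₀ F Mc k + n)).d → Site (F.P (recordK₀ F Mc k + n)) (k + 1) → θ.Vβ =>
        fun b : PBond (F.P (recordK₀ F Mc k + n)) 0 => ((recordBgField F θ k (recordK₀ F Mc k + n) B b : SU 2) : MatA 2)) 0) :
    letI θ := thetaFill F a₀ ε₂₉; letI := θ.instVβ₁; letI := θ.instVβ₂;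
    ContDiffAt ℝ 2 (recordEmbJ F θ k (recordK₀ F Mc k + n)) 0 :=
  contDiffAt_recordEmbJ_of F (thetaFill F a₀ ε₂₉) k (recordK₀ F Mc k + n) (by simp only [T4Family.P_m, T4Family.P_K, recordK₀]; omega) ha₀ hU

/-! ## §4 (v2 APPEND)  NORM BRIDGE: 27931⁷'s token TokP9reg is stated ENTRYWISE (sup norms); it gives the `M₂(ℂ)`-valued `C²` hypothesis of §3, hence (C2a) -/

/-- The identity `(Fin 2 → Fin 2 → ℂ) → M₂(ℂ)` (`Matrix.of`) as a continuous ℝ-linear map from the sup-normed entries to the L²-operator-normed matrices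
(finite dimensions: every linear map is continuous). [folklore] -/
theorem exists_ofCLM : ∃ e : (Fin 2 → Fin 2 → ℂ) →L[ℝ] MatA 2, ∀ v, e v = Matrix.of v :=
  ⟨LinearMap.toContinuousLinearMap ((Matrix.ofLinearEquiv ℝ : (Fin 2 → Fin 2 → ℂ) ≃ₗ[ℝ] MatA 2) : (Fin 2 → Fin 2 → ℂ) →ₗ[ℝ] MatA 2),
    fun _ => rfl⟩

variable {E : Type*} [NormedAddCommGroup E] [NormedSpace ℝ E] {ι : Type*} [Fintype ι]

/-- **NORM BRIDGE**: a bond-indexed family of `2 × 2` matrices that is `Cⁿ` ENTRYWISE (codomain `ι → Fin 2 → Fin 2 → ℂ`, sup norms — the currency of 27931⁷'s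
token TokP9reg) is `Cⁿ` as a family of matrices in the L²-operator norm (codomain `ι → M₂(ℂ)`). [folklore] -/
theorem contDiffAt_matrix_of_entries {n : WithTop ℕ∞} {f : E → ι → MatA 2} {x : E}
    (h : ContDiffAt ℝ n (fun e => fun (b : ι) (i i' : Fin 2) => f e b i i') x) : ContDiffAt ℝ n f x := by
  obtain ⟨eM, heM⟩ := exists_ofCLM
  rw [contDiffAt_pi]
  intro b
  have hb : ContDiffAt ℝ n (fun e => fun (i i' : Fin 2) => f e b i i') x := (contDiffAt_pi.1 h) b
  have hcomp := eM.contDiff.contDiffAt.comp x hb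
  have hfun : (fun e => f e b) = fun e => eM (fun (i i' : Fin 2) => f e b i i') := by
    funext e
    rw [heM]
    ext i i'
    rfl
  rw [hfun]
  exact hcomp

/-- Entrywise ANALYTICITY (over ℝ) gives the same. [folklore] -/
theorem contDiffAt_matrix_of_entries_analyticAt {n : WithTop ℕ∞} {f : E → ι → MatA 2} {x : E}
    (h : AnalyticAt ℝ (fun e => fun (b : ι) (i i' : Fin 2) => f e b i i') x) : ContDiffAt ℝ n f x :=
  contDiffAt_matrix_of_entries h.contDiffAt

variable (F : T4Family)

/-- ★★ **(C2a) FROM 27931⁷'s DISPLAYED TOKEN TokP9reg, VERBATIM SHAPE**: entry-level real-analyticity at `B = 0` of `B ↦ U_{k+1}(W_B)` (θ := thetaFill F a₀ ε₂₉, volume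
`recordK₀ F Mc k + n`) gives the ι-row's `C²` clause `ContDiffAt ℝ 2 (recordEmbJ F θ k (recordK₀ F Mc k + n)) 0`.
[cite: Balaban1985Variational, Prop. 9 p.309; Balaban1987RG1, (4.35) p.290] -/
theorem contDiffAt_recordEmbJ_of_tokP9reg (a₀ ε₂₉ : ℝ) (ha₀ : 0 < a₀) (Mc k n : ℕ)
    (hreg : letI θ := thetaFill F a₀ ε₂₉; letI := θ.instVβ₁; letI := θ.instVβ₂; letI := θ.instιβ;
      AnalyticAt ℝ (fun B : recordW F a₀ ε₂₉ k (recordK₀ F Mc k + n) =>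
        fun (b : PBond (F.P (recordK₀ F Mc k + n)) 0) (i i' : Fin 2) =>
          ((recordBgField F θ k (recordK₀ F Mc k + n) B b : SU 2) : Matrix (Fin 2) (Fin 2) ℂ) i i') 0) :
    letI θ := thetaFill F a₀ ε₂₉; letI := θ.instVβ₁; letI := θ.instVβ₂;
    ContDiffAt ℝ 2 (recordEmbJ F θ k (recordK₀ F Mc k + n)) 0 := by
  letI := (thetaFill F a₀ ε₂₉).instVβ₁; letI := (thetaFill F a₀ ε₂₉).instVβ₂
  exact contDiffAt_recordEmbJ_thetaFill_of F a₀ ε₂₉ ha₀ Mc k n (contDiffAt_matrix_of_entries_analyticAt hreg)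

end Summit.QuantumFields.YangMills.Theorems.PortU8

end
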